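import Mathlib
import HarnessLib
import Summits.HubbardSuperconductivity.HubbardSuperconductivity.Theses.KLProgramme
import Summits.HubbardSuperconductivity.HubbardSuperconductivity.Theorems.KLProgrammeKLRegimeBetaSplitV11

/-!
# Route `KLProgramme` — crux K3 gen 3, child 1 `KLRegimeBetaSplitV11` (stmt-HubbardSuperconductivity-19824) CLOSED BY NAME

Cell gate-hubbard-kl, seat hubbard-kl-k3c1-p2 (child-1 re-closure owner on gen 3).  The route item `KLRegimeBetaSplitV11 := BetaSplitP klPredsV11
klWindowC` (K3 split gen 3: Δ16 count re-staging, Δ17 regime threshold, Δ18 angular two-leg conjunct, Δ19 scale-0 leg term, Δ-stage two-leg sizes) is the theorem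
`betaSplitP_klPredsV11 klWindowC` of `…Theorems.KLProgrammeKLRegimeBetaSplitV11`: the extra-family-generic child-1 closer `betaSplitP_of_extraClauses0`
(`…KLRegimeBetaSplitExtra0`: r2d-p1's repulsive s-wave cascade with sources + p3's frozen increments, generic in the (T)/(D) majorant family)
at the V7S engine slot (`betaSplitP_of_slotsV7S`, numerals `(1, 8, 4/3, 48)`).  One line; nothing new.
-/

namespace Summit.HubbardSuperconductivity.HubbardSuperconductivity.Theorems

set_option linter.dupNamespace false -- summit = problem name (single-conjunct summit), D-0017

/-- **Child 1 of the K3 split (gen 3) holds**: `KLRegimeBetaSplitV11` (= `BetaSplitP klPredsV11 klWindowC`), by `betaSplitP_klPredsV11`. -/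
theorem klRegimeBetaSplitV11_proof :
    Summit.HubbardSuperconductivity.HubbardSuperconductivity.Theses.KLProgramme.KLRegimeBetaSplitV11 :=
  KLRegimeSplit.betaSplitP_klPredsV11 KLRegimeSplit.klWindowC

end Summit.HubbardSuperconductivity.HubbardSuperconductivity.Theorems
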